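import Summits.RiemannHypothesis.RiemannHypothesis.Theorems.SignConeConeMagnificationCombTypeAssemblyPairData
import Summits.RiemannHypothesis.RiemannHypothesis.Theorems.SignConeConeMagnificationTypeConvergence
import Literature.NumberTheory.LFunctions.DesignDataOfTypes

/-!
# Crux `SignCone.ConeMagnification` (stmt-RiemannHypothesis-16303), line `Sketch` r9, stub `stub_combType` — assembly, part 3:
# the registered conclusion from PAIR-LEVEL data for the weight at hand (second interface)

`combType_of_pairData`: for `c ≥ 0` with unit slack, Chebyshev/Mertens (`stub_fakeMertens`) and local summability (`stub_combLocal`),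
IF for every `L ≥ 1` some smooth real bump `b` on `[-1,1]`, constants `B₀ > 0`, `Cst`, `θ < 1` satisfy the PAIR-LEVEL DATA of
`CombType.typeBound_of_pairData` (eventually in `M`, all pairs `ℓ, ℓ' ≤ L`), THEN the conclusion of `stub_combType` holds verbatim:
every finitely supported complex design has a type limit `T ≤ ½ Re Φ_α(1)` (real designs by part 2b′, complex via
`TypeIneq.typeOfRealLimitBound`, the Mertens difference along `ℕ` via the referee's `tendsto_sum_sub_vonMangoldt_div_of_mertens` and
`tendsto_sum_range_of_tendsto_sum_Icc_floor`).  The final glue `stub_combType` = this + the lead's wave-3 node lemmas.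
-/

noncomputable section

-- `Summit.RiemannHypothesis.RiemannHypothesis.…` repeats a namespace component by design (D-0017 layout).
set_option linter.dupNamespace false

open scoped BigOperators ComplexConjugate Topology ArithmeticFunction.vonMangoldt ContDiff
open Complex MeasureTheory Set Filter

namespace Summit.RiemannHypothesis.RiemannHypothesis.Theorems.SignConeConeMagnification

open Literature.NumberTheory.LFunctions
open Literature.NumberTheory.LFunctions.GcdForm (gcdForm)

namespace CombType

/-- **`stub_combType`'s conclusion from pair-level data for the weight at hand.**  See the module docstring. [folklore] -/
theorem combType_of_pairData (c : ℕ → ℝ) (hc0 : ∀ n, 0 ≤ c n)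
    (hU : ∀ g : ℝ → ℂ, IsWeilTest g →
      -(∫ t, ‖g t‖ ^ 2) ≤
        (weilPolarTerm (weilConv g (weilReflect g)) + weilArchTerm (weilConv g (weilReflect g)) -
          ∑' n : ℕ, ((c n : ℝ) : ℂ) / (Real.sqrt n : ℂ) *
            (weilConv g (weilReflect g) (Real.log n) + weilConv g (weilReflect g) (-Real.log n))).re)
    (hMer : ∃ C : ℝ, Tendsto (fun x : ℝ => (∑ n ∈ Finset.Icc 1 ⌊x⌋₊, c n / n) - Real.log x) atTop (𝓝 C))
    (hLoc : ∀ p : ℕ, p.Prime → Summable (fun n : ℕ => if p ∣ n then c n / n else 0))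
    (hpairL : ∀ L : ℕ, 1 ≤ L → ∃ b : ℝ → ℝ, ContDiff ℝ ∞ b ∧ HasCompactSupport b ∧ tsupport b ⊆ Icc (-1) 1 ∧
      ∃ B₀ : ℝ, 0 < B₀ ∧ ∃ Cst θ : ℝ, θ < 1 ∧
      ∀ᶠ M : ℕ in atTop, ∀ ℓ ∈ Finset.Icc 1 L, ∀ ℓ' ∈ Finset.Icc 1 L,
        ∃ S : ℕ → ℝ,
          (∀ δ, |S δ| ≤ Cst * Real.log M ^ θ) ∧
          (|((∑ n ∈ Finset.Icc 1 (3 * L * M), c n *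
              (∑ k' ∈ Finset.Icc 1 M,
                (∑ k ∈ Finset.Icc 1 M, (∫ u, b u * b (u - (Real.log ((n : ℝ) * ℓ' * k' / ℓ) - Real.log k)
                  / (Real.sqrt (Real.log M) / M))) / Real.sqrt k) / Real.sqrt k' / Real.sqrt n)) -
             ∑ n ∈ Finset.Icc 1 (3 * L * M), (Λ n : ℝ) *
              (∑ k' ∈ Finset.Icc 1 M,
                (∑ k ∈ Finset.Icc 1 M, (∫ u, b u * b (u - (Real.log ((n : ℝ) * ℓ' * k' / ℓ) - Real.log k)
                  / (Real.sqrt (Real.log M) / M))) / Real.sqrt k) / Real.sqrt k' / Real.sqrt n)) -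
            ∑ n ∈ Finset.Icc 1 (3 * L * M), (c n - Λ n) *
              (B₀ * (Real.sqrt ℓ / Real.sqrt ℓ') *
                  (∑ k' ∈ Finset.Icc 1 (⌊(M : ℝ) / (4 * Real.sqrt (Real.log M)) / ((n : ℝ) * ℓ')⌋₊),
                    (if ℓ ∣ n * ℓ' * k' then (1 : ℝ) / k' else 0)) / n +
                S (Nat.gcd (n * ℓ') ℓ) / n)| ≤ Cst * Real.log M ^ θ) ∧
          (|(∑ k' ∈ Finset.Icc 1 M,
              (∑ k ∈ Finset.Icc 1 M, (∫ u, b u * b (u - (Real.log (((1 : ℕ) : ℝ) * ℓ' * k' / ℓ) - Real.log k)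
                / (Real.sqrt (Real.log M) / M))) / Real.sqrt k) / Real.sqrt k' / Real.sqrt ((1 : ℕ) : ℝ)) -
            B₀ * ((Nat.gcd ℓ' ℓ : ℝ) / Real.sqrt ((ℓ : ℝ) * ℓ')) * Real.log M| ≤ Cst * Real.log M ^ θ)) :
    ∀ α : ℕ → ℂ, ∀ L : ℕ, (∀ m, L < m → α m = 0) →
      ∃ T : ℝ, Filter.Tendsto (fun x : ℝ => ∑ n ∈ Finset.Icc 1 ⌊x⌋₊,
          (c n - ArithmeticFunction.vonMangoldt n) / n *
            (∑ ℓ ∈ Finset.Icc 1 L, ∑ ℓ' ∈ Finset.Icc 1 L, α ℓ * (starRingEnd ℂ) (α ℓ') *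
            (((Nat.gcd (n * ℓ') ℓ : ℕ) : ℝ) : ℂ) / (Real.sqrt ((ℓ : ℝ) * ℓ') : ℂ)).re) Filter.atTop (nhds T) ∧
        T ≤ 1 / 2 * (∑ ℓ ∈ Finset.Icc 1 L, ∑ ℓ' ∈ Finset.Icc 1 L, α ℓ * (starRingEnd ℂ) (α ℓ') *
            (((Nat.gcd (1 * ℓ') ℓ : ℕ) : ℝ) : ℂ) / (Real.sqrt ((ℓ : ℝ) * ℓ') : ℂ)).re := by
  -- the Mertens difference along `ℕ`
  obtain ⟨C, hC⟩ := hMer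
  have hC₁ : Tendsto (fun N : ℕ => ∑ n ∈ Finset.range N, (c n - Λ n) / n) atTop
      (𝓝 (C + Real.eulerMascheroniConstant)) :=
    TypeDesign.tendsto_sum_range_of_tendsto_sum_Icc_floor (f := fun n => (c n - Λ n) / n) (by simp)
      (TypeDesign.tendsto_sum_sub_vonMangoldt_div_of_mertens hC)
  -- real designs suffice, and the limit exists: it remains to bound it
  refine TypeIneq.typeOfRealLimitBound c hc0 ⟨C, hC⟩ hLoc fun β L hβ T hT => ?_
  -- the type partial sums along `ℕ`, in `gcdForm` notation
  have hT' : Tendsto (fun N : ℕ => ∑ n ∈ Finset.range N,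
      (c n - Λ n) / n * (gcdForm (fun m => ((β m : ℝ) : ℂ)) L n).re) atTop (𝓝 T) :=
    TypeDesign.tendsto_sum_range_of_tendsto_sum_Icc_floor
      (f := fun n => (c n - Λ n) / n * (gcdForm (fun m => ((β m : ℝ) : ℂ)) L n).re) (by simp) hT
  rcases Nat.eq_zero_or_pos L with hL0 | hL
  · -- `L = 0`: the design is empty
    subst hL0
    have h0 : Tendsto (fun N : ℕ => ∑ n ∈ Finset.range N,
        (c n - Λ n) / n * (gcdForm (fun m => ((β m : ℝ) : ℂ)) 0 n).re) atTop (𝓝 0) := by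
      have : (fun N : ℕ => ∑ n ∈ Finset.range N,
          (c n - Λ n) / n * (gcdForm (fun m => ((β m : ℝ) : ℂ)) 0 n).re) = fun _ => 0 := by
        funext N
        refine Finset.sum_eq_zero fun n _ => ?_
        simp [gcdForm]
      rw [this]
      exact tendsto_const_nhds
    have hT0 : T = 0 := tendsto_nhds_unique hT' h0
    rw [hT0]
    simp
  · obtain ⟨b, hb, hbc, hbs, B₀, hB₀, Cst, θ, hθ, hnode⟩ := hpairL L hL
    have := typeBound_of_pairData c hc0 hU hLoc hC₁ hβ hL hb hbc hbs hB₀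
      (fun M ℓ ℓ' n => ∑ k' ∈ Finset.Icc 1 M,
        (∑ k ∈ Finset.Icc 1 M, (∫ u, b u * b (u - (Real.log ((n : ℝ) * ℓ' * k' / ℓ) - Real.log k)
          / (Real.sqrt (Real.log M) / M))) / Real.sqrt k) / Real.sqrt k' / Real.sqrt n)
      (fun _ _ _ _ => rfl) hθ hnode hT'
    simpa only [gcdForm] using this

/-- **Anchor `combTypeOfPairData`** (registered sub-goal; `combType_of_pairData` with explicit quantifiers): pair-level data for the
weight at hand ⟹ the conclusion of `stub_combType` verbatim. [folklore] -/
theorem combTypeOfPairData : ∀ c : ℕ → ℝ, (∀ n, 0 ≤ c n) → (∀ g : ℝ → ℂ, IsWeilTest g → -(∫ t, ‖g t‖ ^ 2) ≤ (weilPolarTerm (weilConv g (weilReflect g)) + weilArchTerm (weilConv g (weilReflect g)) - ∑' n : ℕ, ((c n : ℝ) : ℂ) / (Real.sqrt n : ℂ) * (weilConv g (weilReflect g) (Real.log n) + weilConv g (weilReflect g) (-Real.log n))).re) → (∃ C : ℝ, Filter.Tendsto (fun x : ℝ => (∑ n ∈ Finset.Icc 1 ⌊x⌋₊, c n / n) -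 Real.log x) Filter.atTop (nhds C)) → (∀ p : ℕ, p.Prime → Summable (fun n : ℕ => if p ∣ n then c n / n else 0)) → (∀ L : ℕ, 1 ≤ L → ∃ b : ℝ → ℝ, ContDiff ℝ (⊤ : ℕ∞) b ∧ HasCompactSupport b ∧ tsupport b ⊆ Set.Icc (-1) 1 ∧ ∃ B₀ : ℝ, 0 < B₀ ∧ ∃ Cst θ : ℝ, θ < 1 ∧ ∀ᶠ M : ℕ in Filter.atTop, ∀ ℓ ∈ Finset.Icc 1 L, ∀ ℓ' ∈ Finset.Icc 1 L, ∃ S : ℕ → ℝ, (∀ δ, |S δ| ≤ Cst * Real.log M ^ θ) ∧ (|((∑ n ∈ Finset.Icc 1 (3 * L * M), c n * (∑ k' ∈ Finset.Icc 1 M, (∑ k ∈ Finset.Icc 1 M, (∫ u, b u * b (u - (Real.log ((n : ℝ) * ℓ' * k' / ℓ) - Real.log k) / (Real.sqrt (Real.log M) / M))) / Real.sqrt k) / Real.sqrt k' / Real.sqrt n)) - ∑ n ∈ Finset.Icc 1 (3 * L * M), (ArithmeticFunction.vonMangoldt n : ℝ) * (∑ k' ∈ Finset.Icc 1 M, (∑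 k ∈ Finset.Icc 1 M, (∫ u, b u * b (u - (Real.log ((n : ℝ) * ℓ' * k' / ℓ) - Real.log k) / (Real.sqrt (Real.log M) / M))) / Real.sqrt k) / Real.sqrt k' / Real.sqrt n)) - ∑ n ∈ Finset.Icc 1 (3 * L * M), (c n - ArithmeticFunction.vonMangoldt n) * (B₀ * (Real.sqrt ℓ / Real.sqrt ℓ') * (∑ k' ∈ Finset.Icc 1 (⌊(M : ℝ) / (4 * Real.sqrt (Real.log M)) / ((n : ℝ) * ℓ')⌋₊), (if ℓ ∣ n * ℓ' * k' then (1 : ℝ) / k' else 0)) / n + S (Nat.gcd (n * ℓ') ℓ) / n)| ≤ Cst * Real.log M ^ θ) ∧ (|(∑ k' ∈ Finset.Icc 1 M, (∑ k ∈ Finset.Icc 1 M, (∫ u, b u * b (u - (Real.log (((1 : ℕ) : ℝ) * ℓ' * k' / ℓ) - Real.log k) / (Real.sqrt (Real.log M) / M))) / Real.sqrt k) / Real.sqrt k' / Real.sqrt ((1 : ℕ) : ℝ)) - B₀ * ((Nat.gcd ℓ' ℓ : ℝ) / Real.sqrt ((ℓ : ℝ) * ℓ')) * Real.log M| ≤ Cst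 * Real.log M ^ θ)) → ∀ α : ℕ → ℂ, ∀ L : ℕ, (∀ m, L < m → α m = 0) → ∃ T : ℝ, Filter.Tendsto (fun x : ℝ => ∑ n ∈ Finset.Icc 1 ⌊x⌋₊, (c n - ArithmeticFunction.vonMangoldt n) / n * (∑ ℓ ∈ Finset.Icc 1 L, ∑ ℓ' ∈ Finset.Icc 1 L, α ℓ * (starRingEnd ℂ) (α ℓ') * (((Nat.gcd (n * ℓ') ℓ : ℕ) : ℝ) : ℂ) / (Real.sqrt ((ℓ : ℝ) * ℓ') : ℂ)).re) Filter.atTop (nhds T) ∧ T ≤ 1 / 2 * (∑ ℓ ∈ Finset.Icc 1 L, ∑ ℓ' ∈ Finset.Icc 1 L, α ℓ * (starRingEnd ℂ) (α ℓ') * (((Nat.gcd (1 * ℓ') ℓ : ℕ) : ℝ) : ℂ) / (Real.sqrt ((ℓ : ℝ) * ℓ') : ℂ)).re :=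
  fun c hc0 hU hMer hLoc hpairL => combType_of_pairData c hc0 hU hMer hLoc hpairL

end CombType

end Summit.RiemannHypothesis.RiemannHypothesis.Theorems.SignConeConeMagnification

end
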